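import Summits.ResolutionOfSingularities.ResolutionOfSingularities.Theorems.MarkedTransferCampaignW46ThreefoldsGammaFreeGlobalFamilyStep
import HarnessLib

/-!
# [OURS · L1 W4.6 rung (ii), dimension ladder] LIFTING A CURVE THROUGH THE BLOWING UP OF A POINT AT WHICH IT IS REGULAR, and the
# prime-divisor family after blowing up a point at which every branch is regular (brick B8c / B10b-reg of rung (ii-2))

Cell res-hironaka, LADDER-RESOLUTION rung L (D-0089), slot W4.6, rung (ii) (dimension ladder, res-L1-type-o1 p496755); seat
res-D-pv-049 AS res-L1-s46-pv-11 (holder of rung (ii-2); architecture v2, STATUS 2026-08-27T05:4xZ). Host route MarkedTransfer,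
host item `HypersurfaceOrderReductionDimLeThree` (stmt-ResolutionOfSingularities-16156); proposed `--kind proof --supports` it
`--as helper`. Everything here is OURS scheme theory over the tree's blow-up library; nothing of H. Hironaka's manuscript
[Hironaka2017] is asserted. AI-written; AI review is weaker than expert review.

## What is proved

* `exists_lift_pointBlowup` (B8c) — a closed immersion `i : C ↪ X` of an integral curve whose point over the closed point `x`
  (if any) is a REGULAR point of `C` lifts along the blowing up `π : X′ → X` of `𝓘_{x}` to a closed immersion `j : C ↪ X′`
  with `j ≫ π = i` (the pulled-back centre is Cartier on `C`, so `Bl C ≅ C`; GW 13.96 (2)). This is the strict transform of a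
  branch that is regular at the blown-up point: the SAME curve.
* `exists_family_pointBlowup_of_regular` (B10b-reg) — the family version: if every branch of the prime-divisor family
  `(ζ_k, i_k : C_k ↪ X)` of `V(J)` is regular at its point over `x`, the prime divisors of the controlled transform
  `(J𝒪_{X′}) ⊗ 𝒪(mE)` are presented by the lifts `j_k : C_k ↪ X′` of the SAME curves together with (when `m < ord_x J`) the
  exceptional curve `E` (`Σδ(E) = 0`) — so the `Δ`-component of the termination measure is unchanged, and the local analysis
  at the points over `x` can be done on the original curves.

## Sources

* U. Görtz, T. Wedhorn, *Algebraic Geometry I*, 2nd ed. (2020), Prop. 13.96 (2), (13.19). [GortzWedhorn2020]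
* Q. Liu, *Algebraic Geometry and Arithmetic Curves* (2002), §8.1 Prop. 1.12, Cor. 1.17. [Liu2002]
* H. Hironaka, ms. 2017-03-23, Def. 2.1 p.5 — scope only, under adjudication, not cited as fact. [Hironaka2017]
-/

noncomputable section

set_option linter.dupNamespace false -- mandated namespace of this single-conjunct summit

open CategoryTheory AlgebraicGeometry TopologicalSpace IsLocalRing Topology

namespace Summit.ResolutionOfSingularities.ResolutionOfSingularities.Theorems

namespace CampaignW46

open Literature.AlgebraicGeometry.Resolution
open Scheme.IdealSheafData

universe u

/-! ## B8c: the lift of a curve regular over the centre -/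

/-- **[OURS · W4.6 rung (ii-2), brick B8c] A curve regular over the blown-up point lifts.** `X` locally Noetherian, `i : C ↪ X`
a closed immersion of an integral scheme of dimension `≤ 1` whose generic point does not map to the closed point `x`, and whose
point over `x` (if any) is a regular point of `C`; `π : X′ → X` a blowing up along `𝓘_{x}`. Then there is a closed immersion
`j : C ↪ X′` with `j ≫ π = i` (the centre `𝓘_{x}𝒪_C` is `𝔪_c` at a point where `𝒪_{C,c}` is a discrete valuation ring, hence
Cartier; the blowing up of `C` along it is an isomorphism and maps to `X′` by the universal property, as a closed immersion).
[cite: GortzWedhorn2020, Prop. 13.96 (2)] -/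
theorem exists_lift_pointBlowup {X X' C : Scheme.{u}} [IsLocallyNoetherian X]
    (i : C ⟶ X) [IsClosedImmersion i] [IsIntegral C] [IsLocallyNoetherian C] (hdim : topologicalKrullDim C ≤ 1)
    {x : X} (hx : IsClosed ({x} : Set X)) (hηx : i (genericPoint C) ≠ x)
    {π : X' ⟶ X} (hπ : IsBlowup π (vanishingIdeal ⟨{x}, hx⟩))
    (hreg : ∀ c : C, i c = x → c ∈ Scheme.regularLocus C) :
    ∃ j : C ⟶ X', IsClosedImmersion j ∧ j ≫ π = i := by
  obtain ⟨C₁, ρ, hρ⟩ := exists_isBlowup C ((vanishingIdeal ⟨{x}, hx⟩).comap i)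
  let j₀ : C₁ ⟶ X' := hπ.lift (ρ ≫ i) (by rw [Scheme.IdealSheafData.comap_comp]; exact hρ.isEffectiveCartier)
  have hj₀ : j₀ ≫ π = ρ ≫ i := hπ.lift_comp _ _
  haveI : IsClosedImmersion j₀ := hπ.isClosedImmersion_of_comp_eq hρ hj₀
  -- the centre on `C` is Cartier, so `ρ` is an isomorphism
  have hcart : IsEffectiveCartier ((vanishingIdeal ⟨{x}, hx⟩).comap i) := by
    by_cases hxC : x ∈ Set.range i
    · obtain ⟨c, hcx⟩ := hxC
      have hcgen : c ≠ genericPoint C := fun h => hηx (h ▸ hcx)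
      haveI hDVR : IsDiscreteValuationRing (C.presheaf.stalk c) :=
        isDiscreteValuationRing_stalk_of_mem_regularLocus hdim (hreg c hcx) hcgen
      refine isEffectiveCartier_of_stalkIdeal_eq_span_singleton fun y hy => ?_
      have hy' : y ∈ ((((vanishingIdeal ⟨{x}, hx⟩).comap i).support : Set C)) := hy
      rw [support_comap_vanishingIdeal_singleton i hx hcx] at hy'
      obtain rfl : y = c := hy'
      obtain ⟨ϖ, hϖ⟩ := IsDiscreteValuationRing.exists_irreducible (C.presheaf.stalk y)
      refine ⟨ϖ, hϖ.ne_zero, ?_⟩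
      rw [stalkIdeal_comap_vanishingIdeal_singleton i hx hcx]
      exact (IsDiscreteValuationRing.irreducible_iff_uniformizer ϖ).mp hϖ
    · have htop : (vanishingIdeal ⟨{x}, hx⟩).comap i = ⊤ := by
        rw [← support_eq_bot_iff]
        ext y
        simp only [Scheme.IdealSheafData.support_comap, Closeds.coe_preimage, coe_support_vanishingIdeal, Closeds.coe_bot,
          Set.mem_preimage, Set.mem_empty_iff_false, iff_false]
        exact fun h => hxC ⟨y, h⟩
      rw [htop]
      exact isEffectiveCartier_top
  haveI : IsIso ρ := hρ.isIso hcart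
  refine ⟨inv ρ ≫ j₀, inferInstance, ?_⟩
  rw [Category.assoc, hj₀, IsIso.inv_hom_id_assoc]

/-! ## B10b-reg: the prime-divisor family after blowing up a point at which every branch is regular -/

/-- **[OURS · W4.6 rung (ii-2), brick B10b-reg] The prime-divisor family after blowing up a point at which all branches are
regular.** Setting of `exists_family_pointBlowup` (brick B10b-fam), plus: every curve `C_k` is regular at its points over `x`.
Then there are closed immersions `j_k : C_k ↪ X′` with `j_k ≫ π = i_k` (brick B8c) and the generic point `η` of the exceptional
curve such that the family `k ↦ j_k(η_{C_k})`, `⋆ ↦ η` (the latter only when `m < ord_x J`) is injective with image EXACTLY the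
set of codimension-one points of `V(J′)`, `J′ = (J𝒪_{X′}) ⊗ 𝒪(mE)` the controlled transform; and the exceptional curve
`E = V(𝓘_{cl η})` is an integral Noetherian quasi-excellent regular curve with `Σδ(E) = 0`.
[cite: Liu2002, §8.1 Prop. 1.12] [cite: StacksProject, Tag 02OS] -/
theorem exists_family_pointBlowup_of_regular {X X' : Scheme.{u}} [IsIntegral X] [IsNoetherian X] (hX : Scheme.IsRegular X)
    (hXq : Scheme.IsQuasiExcellent X) (hdim : topologicalKrullDim X ≤ 2) {x : X} (hx : IsClosed ({x} : Set X))
    (hxne : ({x} : Set X) ≠ Set.univ) {π : X' ⟶ X} (hπ : IsBlowup π (vanishingIdeal ⟨{x}, hx⟩))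
    (J : X.IdealSheafData) (m : ℕ) (hxJ : x ∉ divisorialPoints J)
    {ι : Type} (ζ : ι → X) (C : ι → Scheme.{u}) (i : ∀ k, C k ⟶ X) (hζinj : Function.Injective ζ)
    (hζrange : Set.range ζ = divisorialPoints J)
    (hfam : ∀ k, IsClosedImmersion (i k) ∧ ∃ (_ : IsIntegral (C k)) (_ : IsNoetherian (C k)),
      Scheme.IsQuasiExcellent (C k) ∧ topologicalKrullDim (C k) ≤ 1 ∧ i k (genericPoint (C k)) = ζ k)
    (hreg : ∀ k (c : C k), i k c = x → c ∈ Scheme.regularLocus (C k)) :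
    ∃ (j : ∀ k, C k ⟶ X') (η : X'), IsGenericPoint η (π ⁻¹' ({x} : Set X)) ∧
      (∀ k, IsClosedImmersion (j k) ∧ j k ≫ π = i k ∧
        (haveI : IsIntegral (C k) := (hfam k).2.1; π (j k (genericPoint (C k))) = ζ k)) ∧
      Function.Injective (Sum.elim (fun k => haveI : IsIntegral (C k) := (hfam k).2.1; j k (genericPoint (C k)))
        (fun _ : PLift ((m : ℕ∞) < idealOrder J x) => η)) ∧
      Set.range (Sum.elim (fun k => haveI : IsIntegral (C k) := (hfam k).2.1; j k (genericPoint (C k)))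
        (fun _ : PLift ((m : ℕ∞) < idealOrder J x) => η)) =
        divisorialPoints (controlledTransform π (vanishingIdeal ⟨{x}, hx⟩) J m) ∧
      ∃ (_ : IsIntegral (primeDivisorIdeal η).subscheme) (_ : IsNoetherian (primeDivisorIdeal η).subscheme),
        Scheme.IsQuasiExcellent (primeDivisorIdeal η).subscheme ∧ topologicalKrullDim (primeDivisorIdeal η).subscheme ≤ 1 ∧
        (primeDivisorIdeal η).subschemeι (genericPoint (primeDivisorIdeal η).subscheme) = η ∧
        Scheme.IsRegular (primeDivisorIdeal η).subscheme ∧ ∑ᶠ y, pointDelta (primeDivisorIdeal η).subscheme y = 0 := by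
  classical
  haveI : IsLocallyNoetherian X := inferInstance
  haveI : IsIntegral X' := hπ.isIntegral (vanishingIdeal_singleton_ne_bot hx hxne)
  haveI : IsProper π := hπ.isProper
  haveI : IsLocallyNoetherian X' := LocallyOfFiniteType.isLocallyNoetherian π
  haveI : CompactSpace X' := QuasiCompact.compactSpace_of_compactSpace π
  haveI : IsNoetherian X' := {}
  have hXq' : Scheme.IsQuasiExcellent X' := hπ.isQuasiExcellent hXq
  have hdim' : topologicalKrullDim X' ≤ 2 := hπ.topologicalKrullDim_le hdim
  -- the exceptional generic point
  obtain ⟨η, hη⟩ := exists_isGenericPoint_exc hX hx hxne hπ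
  have hηx : π η = x := apply_excGen_eq hη
  have hgx : genericPoint X ≠ x := fun h' => hxne (by rw [← hx.closure_eq, ← h', genericPoint_closure])
  have hEne : closure ({η} : Set X') ≠ Set.univ := by
    intro h
    obtain ⟨z, hz⟩ := exists_eq_of_ne_centre hx hπ hgx
    have hzE : z ∈ closure ({η} : Set X') := h ▸ Set.mem_univ z
    rw [hη] at hzE
    exact hgx (hz.symm.trans hzE)
  -- the lifts, member by member (brick B8c)
  have hζx : ∀ k, ζ k ≠ x := fun k h => hxJ (h ▸ (hζrange ▸ ⟨k, rfl⟩ : ζ k ∈ divisorialPoints J))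
  have step : ∀ k, ∃ j : C k ⟶ X', IsClosedImmersion j ∧ j ≫ π = i k := by
    intro k
    obtain ⟨hci, hint, hN, hq, hd, hgen⟩ := hfam k
    haveI := hci; haveI := hint; haveI := hN
    exact exists_lift_pointBlowup (i k) hd hx (by rw [hgen]; exact hζx k) hπ (hreg k)
  choose j hj hjπ using step
  have hgen' : ∀ k, haveI : IsIntegral (C k) := (hfam k).2.1; π (j k (genericPoint (C k))) = ζ k := by
    intro k
    rw [← Scheme.Hom.comp_apply, hjπ, (hfam k).2.2.2.2.2]
  have hne : ∀ k, haveI : IsIntegral (C k) := (hfam k).2.1; π (j k (genericPoint (C k))) ≠ x := fun k => by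
    rw [hgen']; exact hζx k
  refine ⟨j, η, hη, fun k => ⟨hj k, hjπ k, hgen' k⟩, ?_, ?_, ?_⟩
  · -- injectivity
    rintro (k | s) (l | t) h
    · simp only [Sum.elim_inl] at h
      have h1 : (haveI : IsIntegral (C k) := (hfam k).2.1; π (j k (genericPoint (C k)))) =
          (haveI : IsIntegral (C l) := (hfam l).2.1; π (j l (genericPoint (C l)))) := by rw [h]
      rw [hgen', hgen'] at h1
      rw [hζinj h1]
    · simp only [Sum.elim_inl, Sum.elim_inr] at h
      exact absurd (by rw [h, hηx]) (hne k)
    · simp only [Sum.elim_inl, Sum.elim_inr] at h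
      exact absurd (by rw [← h, hηx]) (hne l)
    · rcases s with ⟨s⟩; rcases t with ⟨t⟩; rfl
  · -- the images are exactly the prime divisors of `J′`
    ext ξ'
    constructor
    · rintro ⟨k' | s, rfl⟩
      · simp only [Sum.elim_inl]
        rw [mem_divisorialPoints_controlledTransform_iff_of_ne hx hπ (hne k') J m, hgen', ← hζrange]
        exact ⟨k', rfl⟩
      · exact (excGen_mem_divisorialPoints_iff hX hx hxne hπ hη J m).mpr s.down
    · intro hξ'
      by_cases hξ'x : π ξ' = x
      · have heq := eq_excGen_of_mem_divisorialPoints hX hx hxne hπ hη hξ'x hξ'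
        refine ⟨Sum.inr ⟨(excGen_mem_divisorialPoints_iff hX hx hxne hπ hη J m).mp (heq ▸ hξ')⟩, ?_⟩
        simp only [Sum.elim_inr]
        exact heq.symm
      · have hmem : π ξ' ∈ divisorialPoints J :=
          (mem_divisorialPoints_controlledTransform_iff_of_ne hx hπ hξ'x J m).mp hξ'
        rw [← hζrange] at hmem
        obtain ⟨k, hk⟩ := hmem
        refine ⟨Sum.inl k, eq_of_apply_eq_of_ne_centre hx hπ (hne k) ?_⟩
        simp only [Sum.elim_inl]
        rw [hgen', hk]
  · -- the exceptional curve
    haveI hE : IsIntegral (primeDivisorIdeal η).subscheme :=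
      isIntegral_subscheme_vanishingIdeal _ isIrreducible_singleton.closure
    haveI : IsLocallyNoetherian (primeDivisorIdeal η).subscheme :=
      LocallyOfFiniteType.isLocallyNoetherian (primeDivisorIdeal η).subschemeι
    haveI : CompactSpace (primeDivisorIdeal η).subscheme :=
      QuasiCompact.compactSpace_of_compactSpace (primeDivisorIdeal η).subschemeι
    haveI hNE : IsNoetherian (primeDivisorIdeal η).subscheme := {}
    have hreg : Scheme.IsRegular (primeDivisorIdeal η).subscheme := isRegular_subscheme_primeDivisorIdeal_excGen hX hx hπ hη
    have hdE := topologicalKrullDim_subscheme_primeDivisorIdeal_le_one hdim' hEne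
    refine ⟨hE, hNE, Scheme.IsQuasiExcellent.of_isClosedImmersion (primeDivisorIdeal η).subschemeι hXq', hdE,
      subschemeι_genericPoint_primeDivisorIdeal η, hreg, ?_⟩
    exact finsum_eq_zero_of_forall_eq_zero fun y => pointDelta_eq_zero_of_isRegularLocalRing hdE y (hreg y)

end CampaignW46

end Summit.ResolutionOfSingularities.ResolutionOfSingularities.Theorems

end
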